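import Summits.ValiantsHypothesis.ValiantsHypothesis.Theorems.KPlusLogSqLawRealDiagonalLetterNormalForm

/-!
# Route «KPlusLogSqLaw» — diagonal-letter normal form, sharpened: ALL LETTERS BUT ONE diagonal

HONEST FRAMING.  Helper bookkeeping for the OPEN crux `WeakLifting` (stmt-ValiantsHypothesis-19561, route `KPlusLogSqLaw`, cell
`pub-symmetroid`; seat val-sym-lift-p4 g25, 2026-08-29), a one-step sharpening of `…KPlusLogSqLawRealDiagonalLetterNormalForm`
(there: all letters but TWO diagonal).  Nothing here asserts `WeakLifting`, `TropicalB`, Conjecture B (`KPlusLogSqLaw`), `MatrixDescartes`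
(stmt-ValiantsHypothesis-18050) or anything about VP ≠ VNP.

THE POINT.  Scale ALSO the last `m` rows of the Schur linearisation by `X^M` (`M = ∑ l, d l`): `H' = [[diag X^{M − d p.2}, X^M·W], [X^M·C, 0]]`
has `det H' = (∏ p, X^{M − d p.2}) · (X^M)^m · det F` exactly (`det_diagLetterOne`), and its two constant patterns `W` (top right) and `C = (−S)`
(bottom left) now sit at the SAME exponent `M`: `H'` is a `(K+1)`-letter pencil of size `m·K + m` with ONE general letter `[[0, W], [C, 0]]` and
`K` DIAGONAL `0/1` letters (`exists_diagLetterOne_det_eq`).  Hence `genRootLawAt_of_diagLetterOne` (diagonal-letter general rows at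
`(m·K + m, K + 1)` bound `GenRootLawAt m K`) and ★ `kPlusLogSqLaw_iff_genDiagLetterOne`: **Conjecture B ⟺ `∃ C`, every real lacunary pencil
`X^{d₀}·A + ∑_{l ≥ 1} X^{d_l}·D_l` with ONE arbitrary real matrix `A` and DIAGONAL `D_l` has at most `2^(C (K + ⌊log₂ n⌋²))` distinct real zeros of
its determinant** (`K` = number of letters, `n` = size).  Up to the monomial `X^{n d₀}` this determinant is the principal-minor polynomial
`det(A + diag u)` on the monomial curve `u_i = X^{d_{l(i)} − d₀}` (reading; not used).
[folklore] block-diagonal scaling of a companion linearisation.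
-/

set_option linter.dupNamespace false
set_option autoImplicit false

namespace Summit.ValiantsHypothesis.ValiantsHypothesis.Theorems.KPlusLogSqLaw.RealStatic

open Summit.ValiantsHypothesis.ValiantsHypothesis.Theorems.LacunarySymmetroidMatrixDescartes (RealRootLawAt KPlusLogSqLaw)
open Summit.ValiantsHypothesis.ValiantsHypothesis.Theorems.LacunarySymmetroidMatrixDescartes.Census
  (realRootLawAt_mono card_roots_le_of_mul)
open Summit.ValiantsHypothesis.ValiantsHypothesis.Theorems.LacunarySymmetroidMatrixDescartes.TropicalCensus (realRootLawAt_zero)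
open Summit.ValiantsHypothesis.ValiantsHypothesis.Theorems.KPlusLogSqLaw.RealDoubling
  (GenRootLawAt realRootLawAt_of_genRootLawAt genRootLawAt_of_realRootLawAt_double)
open scoped BigOperators Matrix
open Polynomial

section Ring

variable {R : Type*} [CommRing R] {m K : ℕ}

/-- **one general letter, exact determinant**: with `M = ∑ l, d l`,
`det [[diag X^{M − d p.2}, X^M·[p.1 = j]], [X^M·(−S p.2 i p.1), 0]] = (∏ p, X^{M − d p.2}) · (X^M)^m · det (∑ l, X^{d l} • S l)`. [folklore] -/
theorem det_diagLetterOne (d : Fin K → ℕ) (S : Fin K → Matrix (Fin m) (Fin m) R) :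
    (Matrix.fromBlocks (Matrix.diagonal fun p : Fin m × Fin K => (X : R[X]) ^ (∑ l, d l - d p.2))
        (Matrix.of fun (p : Fin m × Fin K) (j : Fin m) => if p.1 = j then (X : R[X]) ^ (∑ l, d l) else 0)
        (Matrix.of fun (i : Fin m) (p : Fin m × Fin K) => (X : R[X]) ^ (∑ l, d l) * Polynomial.C (-(S p.2 i p.1)))
        (0 : Matrix (Fin m) (Fin m) R[X])).det
      = (∏ p : Fin m × Fin K, (X : R[X]) ^ (∑ l, d l - d p.2)) * ((X : R[X]) ^ (∑ l, d l)) ^ m *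
          (∑ l, (X : R[X]) ^ d l • (S l).map Polynomial.C).det := by
  set M := ∑ l, d l with hM
  have hfac : Matrix.fromBlocks (Matrix.diagonal fun p : Fin m × Fin K => (X : R[X]) ^ (M - d p.2))
        (Matrix.of fun (p : Fin m × Fin K) (j : Fin m) => if p.1 = j then (X : R[X]) ^ M else 0)
        (Matrix.of fun (i : Fin m) (p : Fin m × Fin K) => (X : R[X]) ^ M * Polynomial.C (-(S p.2 i p.1)))
        (0 : Matrix (Fin m) (Fin m) R[X])
      = Matrix.fromBlocks (1 : Matrix (Fin m × Fin K) (Fin m × Fin K) R[X]) 0 0 ((X : R[X]) ^ M • (1 : Matrix (Fin m) (Fin m) R[X])) *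
        Matrix.fromBlocks (Matrix.diagonal fun p : Fin m × Fin K => (X : R[X]) ^ (M - d p.2))
          (Matrix.of fun (p : Fin m × Fin K) (j : Fin m) => if p.1 = j then (X : R[X]) ^ M else 0)
          (Matrix.of fun (i : Fin m) (p : Fin m × Fin K) => Polynomial.C (-(S p.2 i p.1)))
          (0 : Matrix (Fin m) (Fin m) R[X]) := by
    rw [Matrix.fromBlocks_multiply]
    simp only [Matrix.one_mul, Matrix.zero_mul, add_zero, Matrix.mul_zero, zero_add, Matrix.smul_mul, Matrix.one_mul]
    congr 1
  rw [hfac, Matrix.det_mul, Matrix.det_fromBlocks_zero₂₁, Matrix.det_one, one_mul, Matrix.det_smul, Matrix.det_one, mul_one,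
    Fintype.card_fin, det_diagLetter]
  ring

/-- the explicit coefficient family (exponent `M` for the one general letter `[[0, W], [−S, 0]]`, then `M − d l` for the diagonal letters)
sums to `H'`. [folklore] -/
theorem pencil_diagCoeffOne (d : Fin K → ℕ) (S : Fin K → Matrix (Fin m) (Fin m) R) :
    (∑ l', (X : R[X]) ^ (Fin.cons (∑ l, d l) (fun l => ∑ l, d l - d l) : Fin (K + 1) → ℕ) l' •
        ((Fin.cons (Matrix.fromBlocks (0 : Matrix (Fin m × Fin K) (Fin m × Fin K) R)
              (Matrix.of fun (p : Fin m × Fin K) (j : Fin m) => if p.1 = j then (1 : R) else 0)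
              (Matrix.of fun (i : Fin m) (p : Fin m × Fin K) => -(S p.2 i p.1)) (0 : Matrix (Fin m) (Fin m) R))
            (fun l : Fin K => Matrix.fromBlocks
              (Matrix.diagonal fun p : Fin m × Fin K => if p.2 = l then (1 : R) else 0)
              0 0 (0 : Matrix (Fin m) (Fin m) R)) :
            Fin (K + 1) → Matrix ((Fin m × Fin K) ⊕ Fin m) ((Fin m × Fin K) ⊕ Fin m) R) l').map Polynomial.C)
      = Matrix.fromBlocks (Matrix.diagonal fun p : Fin m × Fin K => (X : R[X]) ^ (∑ l, d l - d p.2))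
          (Matrix.of fun (p : Fin m × Fin K) (j : Fin m) => if p.1 = j then (X : R[X]) ^ (∑ l, d l) else 0)
          (Matrix.of fun (i : Fin m) (p : Fin m × Fin K) => (X : R[X]) ^ (∑ l, d l) * Polynomial.C (-(S p.2 i p.1)))
          (0 : Matrix (Fin m) (Fin m) R[X]) := by
  refine Matrix.ext fun x y => ?_
  rw [Matrix.sum_apply, Fin.sum_univ_succ]
  simp only [Fin.cons_zero, Fin.cons_succ, Matrix.smul_apply, Matrix.map_apply, smul_eq_mul]
  rcases x with p | i <;> rcases y with q | j
  · simp only [Matrix.fromBlocks_apply₁₁, Matrix.zero_apply, Polynomial.C_0, mul_zero, zero_add, Matrix.diagonal_apply,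
      apply_ite Polynomial.C, Polynomial.C_1, mul_ite, mul_one]
    by_cases h : p = q
    · subst h
      simp only [if_true]
      rw [Finset.sum_ite_eq Finset.univ p.2 (fun l => (X : R[X]) ^ (∑ l', d l' - d l))]
      simp
    · simp [h]
  · simp [apply_ite Polynomial.C]
  · simp
  · simp

/-- the letters of index `≥ 1` of the one-general-letter family are diagonal. [folklore] -/
theorem diagCoeffOne_offdiag (S : Fin K → Matrix (Fin m) (Fin m) R) (l' : Fin (K + 1)) (hl' : 1 ≤ (l' : ℕ))
    (x y : (Fin m × Fin K) ⊕ Fin m) (hxy : x ≠ y) :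
    (Fin.cons (Matrix.fromBlocks (0 : Matrix (Fin m × Fin K) (Fin m × Fin K) R)
          (Matrix.of fun (p : Fin m × Fin K) (j : Fin m) => if p.1 = j then (1 : R) else 0)
          (Matrix.of fun (i : Fin m) (p : Fin m × Fin K) => -(S p.2 i p.1)) (0 : Matrix (Fin m) (Fin m) R))
        (fun l : Fin K => Matrix.fromBlocks
          (Matrix.diagonal fun p : Fin m × Fin K => if p.2 = l then (1 : R) else 0)
          0 0 (0 : Matrix (Fin m) (Fin m) R)) :
        Fin (K + 1) → Matrix ((Fin m × Fin K) ⊕ Fin m) ((Fin m × Fin K) ⊕ Fin m) R) l' x y = 0 := by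
  obtain ⟨l, rfl⟩ : ∃ l : Fin K, l' = l.succ := ⟨l'.pred (by intro h; simp [h] at hl'), by simp⟩
  simp only [Fin.cons_succ]
  rcases x with p | i <;> rcases y with q | j
  · have hpq : p ≠ q := fun h => hxy (by rw [h])
    simp [Matrix.diagonal_apply_ne _ hpq]
  · simp
  · simp
  · simp

/-- **one general letter, existence form** (any commutative ring): every `K`-term `m × m` pencil is, up to an explicit monomial factor, the
determinant of a `(K+1)`-term pencil of size `m·K + m` ALL OF WHOSE LETTERS OF INDEX ≥ 1 ARE DIAGONAL. [folklore] -/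
theorem exists_diagLetterOne_det_eq (d : Fin K → ℕ) (S : Fin K → Matrix (Fin m) (Fin m) R) :
    ∃ (d' : Fin (K + 1) → ℕ) (E : Fin (K + 1) → Matrix (Fin (m * K + m)) (Fin (m * K + m)) R),
      (∀ l' : Fin (K + 1), 1 ≤ (l' : ℕ) → ∀ x y, x ≠ y → E l' x y = 0) ∧
      (∑ l', (X : R[X]) ^ d' l' • (E l').map Polynomial.C).det
        = (∏ p : Fin m × Fin K, (X : R[X]) ^ (∑ l, d l - d p.2)) * ((X : R[X]) ^ (∑ l, d l)) ^ m *
            (∑ l, (X : R[X]) ^ d l • (S l).map Polynomial.C).det := by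
  classical
  let e : (Fin m × Fin K) ⊕ Fin m ≃ Fin (m * K + m) := (Equiv.sumCongr finProdFinEquiv (Equiv.refl (Fin m))).trans finSumFinEquiv
  let T : Fin (K + 1) → Matrix ((Fin m × Fin K) ⊕ Fin m) ((Fin m × Fin K) ⊕ Fin m) R :=
    Fin.cons (Matrix.fromBlocks (0 : Matrix (Fin m × Fin K) (Fin m × Fin K) R)
        (Matrix.of fun (p : Fin m × Fin K) (j : Fin m) => if p.1 = j then (1 : R) else 0)
        (Matrix.of fun (i : Fin m) (p : Fin m × Fin K) => -(S p.2 i p.1)) (0 : Matrix (Fin m) (Fin m) R))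
      (fun l : Fin K => Matrix.fromBlocks
        (Matrix.diagonal fun p : Fin m × Fin K => if p.2 = l then (1 : R) else 0)
        0 0 (0 : Matrix (Fin m) (Fin m) R))
  refine ⟨Fin.cons (∑ l, d l) fun l => ∑ l, d l - d l, fun l' => Matrix.reindex e e (T l'), ?_, ?_⟩
  · intro l' hl' x y hxy
    simp only [Matrix.reindex_apply, Matrix.submatrix_apply]
    exact diagCoeffOne_offdiag S l' hl' (e.symm x) (e.symm y) (fun h => hxy (e.symm.injective h))
  · have hre : (∑ l', (X : R[X]) ^ (Fin.cons (∑ l, d l) (fun l => ∑ l, d l - d l) : Fin (K + 1) → ℕ) l' •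
          (Matrix.reindex e e (T l')).map Polynomial.C)
        = Matrix.reindex e e (∑ l', (X : R[X]) ^ (Fin.cons (∑ l, d l) (fun l => ∑ l, d l - d l) :
            Fin (K + 1) → ℕ) l' • (T l').map Polynomial.C) := by
      refine Matrix.ext fun x y => ?_
      simp [Matrix.sum_apply]
    rw [hre, Matrix.det_reindex_self, pencil_diagCoeffOne, det_diagLetterOne]

end Ring

/-! ## Row transfer over `ℝ` and the equivalence with Conjecture B -/

section Rows

variable {m K : ℕ}

/-- **One-general-letter rows bound general rows**: if every general real pencil of format `(m·K + m, K + 1)` whose letters of index `≥ 1` are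
diagonal has at most `B` distinct real zeros of its determinant, then so does every general real pencil of format `(m, K)`. [folklore] -/
theorem genRootLawAt_of_diagLetterOne {B : ℕ}
    (h : ∀ (d' : Fin (K + 1) → ℕ) (E : Fin (K + 1) → Matrix (Fin (m * K + m)) (Fin (m * K + m)) ℝ),
      (∀ l' : Fin (K + 1), 1 ≤ (l' : ℕ) → ∀ x y, x ≠ y → E l' x y = 0) →
      (Matrix.det (∑ l, ((Polynomial.X : Polynomial ℝ) ^ d' l) • (E l).map Polynomial.C)).roots.toFinset.card ≤ B) :
    GenRootLawAt m K B := by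
  intro d S
  obtain ⟨d', E, hdiag, hdet⟩ := exists_diagLetterOne_det_eq (R := ℝ) d S
  have hbig := h d' E hdiag
  rw [hdet, mul_comm] at hbig
  exact ((card_roots_le_of_mul _ _ (mul_ne_zero (prod_X_pow_ne_zero d)
    (pow_ne_zero _ (pow_ne_zero _ Polynomial.X_ne_zero)))).1).trans hbig

/-- size arithmetic, one-general-letter format: `1 ≤ K`, `K + 1 ≤ m ⇒ C((K+1) + ⌊log₂ (mK+m)⌋²) ≤ 11·C·(K + ⌊log₂ m⌋²)`. [folklore] -/
theorem diagOne_size_exponent_le (C m K : ℕ) (hK : 1 ≤ K) (hKm : K + 1 ≤ m) :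
    C * ((K + 1) + Nat.log 2 (m * K + m) ^ 2) ≤ 11 * C * (K + Nat.log 2 m ^ 2) :=
  (Nat.mul_le_mul_left _ (by omega)).trans (diag_size_exponent_le C m K hK hKm)

/-- **Conjecture B ⟺ Conjecture B for general pencils `X^{d₀}·A + ∑_{l≥1} X^{d_l}·D_l` with ONE arbitrary letter and DIAGONAL `D_l`.**
An EQUIVALENCE between OPEN statements; neither side is asserted. [folklore] -/
theorem kPlusLogSqLaw_iff_genDiagLetterOne :
    KPlusLogSqLaw ↔ ∃ C : ℕ, ∀ (n K' : ℕ) (d : Fin K' → ℕ) (E : Fin K' → Matrix (Fin n) (Fin n) ℝ),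
      (∀ l : Fin K', 1 ≤ (l : ℕ) → ∀ x y, x ≠ y → E l x y = 0) →
      (Matrix.det (∑ l, ((Polynomial.X : Polynomial ℝ) ^ d l) • (E l).map Polynomial.C)).roots.toFinset.card
        ≤ 2 ^ (C * (K' + Nat.log 2 n ^ 2)) := by
  constructor
  · rintro ⟨C, hC⟩
    refine ⟨3 * C, fun n K' d E _ => ?_⟩
    rcases Nat.eq_zero_or_pos K' with rfl | hK
    · exact realRootLawAt_zero n _ d E (fun l => l.elim0)
    have hgen : GenRootLawAt n K' (2 ^ (C * (K' + Nat.log 2 (n + n) ^ 2))) :=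
      genRootLawAt_of_realRootLawAt_double (hC (n + n) K')
    exact (hgen d E).trans (Nat.pow_le_pow_right two_pos (double_size_exponent_le C n K' hK))
  · rintro ⟨C, hC⟩
    refine ⟨11 * C + 2, fun m K => ?_⟩
    rcases Nat.eq_zero_or_pos K with rfl | hK
    · exact realRootLawAt_zero m _
    by_cases hmK : m ≤ K
    · refine realRootLawAt_mono ?_ (realRootLawAt_fatCone_zero m K hmK)
      exact Nat.pow_le_pow_right two_pos (Nat.mul_le_mul_right _ (by omega))
    · have hKm : K + 1 ≤ m := by omega
      refine realRootLawAt_mono ?_ (realRootLawAt_of_genRootLawAt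
        (genRootLawAt_of_diagLetterOne fun d' E hdiag => hC _ _ d' E hdiag))
      exact Nat.pow_le_pow_right two_pos
        ((diagOne_size_exponent_le C m K hK hKm).trans (Nat.mul_le_mul_right _ (by omega)))

end Rows

end Summit.ValiantsHypothesis.ValiantsHypothesis.Theorems.KPlusLogSqLaw.RealStatic
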